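import Literature.AnabelianGeometry.AbsoluteAnabelian.AbsTopII.DecompositionGroups
import Literature.AnabelianGeometry.AbsoluteAnabelian.AbsTopII.InertiaGroups

/-!
# [AbsTopII] Prop 1.3 (iv), (viii), (x) as typed: the CONJUGACY SCOPE — kernel certificates

S. Mochizuki, *Topics in Absolute Anabelian Geometry II* [AbsTopII] (bib `MochizukiAbsTopII2013`;
locators = PDF pages of the kurims manuscript `paper:url-585b8d0ad0d9`), §1, Def 1.2 (ii) p. 10 and
Prop 1.3 (iv), (viii), (x) pp. 11–12.

PRINT (Def 1.2 (ii) p. 10): "each vertex `v` (respectively, edge `e`) of `𝔾` determines [up to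
conjugation in `Π_𝔾`] a subgroup `Π_v ⊆ Π_𝔾` (respectively, `Π_e ⊆ Π_𝔾`), whose normalizer
`D_v := N_{Π_H}(Π_v)` (respectively, `D_e := N_{Π_H}(Π_e)`) in `Π_H` we shall refer to as the
decomposition group"; `Π_H = Π_𝔾 ⋊^{out} H` for a continuous `ρ_H : H → Aut(𝔾) (⊆ Out(Π_𝔾))`.
Thus the subgroups named in Prop 1.3 (iv) "`D_v ∩ D_{v'} ∩ Π_I ≠ {1} ⇒ (1) ∨ (2) ∨ (3)`", (viii)
"`D_e ∩ D_{e'} ∩ Π_I ≠ {1} ⇒ …`" and (x) "`τ_I(I) ⊆ D_{e_τ}` [for an appropriate choice of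
conjugate]" are determined up to `Π_𝔾`-CONJUGACY.  An element `h ∈ H` acts on the semi-graph of
anabelioids `𝔾` through `ρ_H(h) ∈ Aut(𝔾)` and may MOVE the vertex `v'` to another vertex `σ_h(v')`;
for `g ∈ Π_H` over such `h`, the `Π_H`-conjugate `g·Π_{v'}·g⁻¹` is a `Π_𝔾`-conjugate of
`Π_{σ_h(v')}`, NOT of `Π_{v'}`, and `g·D_{v'}·g⁻¹` is a decomposition group of `σ_h(v')`.

The cell's typings quantify the conjugating element over ALL of `Π_H`:
abc-iut-L4-t4's `DPSCData.Prop13iv` (`∀ (v v') (g : X.PiH), X.Dv v ⊓ MulAut.conj g • X.Dv v' ⊓ X.PiI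
≠ ⊥ → v = v' ∨ …` and `X.Iv v ⊓ MulAut.conj g • X.Iv v' ≠ ⊥ → v = v'`; FACT-LIST F-0276) and
abc-iut-L4-t6's `DPSCIndexData.Prop_1_3_viii` / `Prop_1_3_x` (`AbsTopII/InertiaGroups.lean`,
p405221; "typed for every `Π_H`-conjugate of the chosen `D_{e'}`").  This proof-only file records,
as KERNEL CERTIFICATES (pure group theory over the abstract data, no new definitions), that these
typed forms FAIL on any DPSC data in which some `g ∈ Π_H` carries `Π_{v'}` onto `Π_v` for vertices
`v ≠ v'` (with `I_v ≠ 1`, as Prop 1.3 (iii) `I_v ≅ Ẑ^Σ` guarantees), respectively `Π_{e'}` onto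
`Π_e` for edges `e ≠ e'` (with `Π_e ≠ 1`), respectively moves every cusp (with a non-verticial,
non-edge-like log point present) — situations Def 1.2 (ii) allows (e.g. `H ⊇ I` finite-by-`I`
acting on a stable curve whose dual graph has a symmetry exchanging two far-apart components or two
cusps).  The REPAIR proposed to the typers of record is to quantify the conjugating element over
`Π_𝔾` (`(γ : X.PiH) (hγ : γ ∈ X.PiG)`), the printed conjugacy scope; the group-theoretic layer of
the printed proof (`AbsTopII/InertiaDecompositionCore.lean`, `…Proofs.lean`) is unaffected (its
"(iv) at open subgroups" input `I_v ∩ γ·I_v·γ⁻¹ ≠ {1} ⇒ Π_v = γ·Π_v·γ⁻¹` is printed with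
`γ ∈ Π_H`, p. 16, and is consistent with vertex-moving `H`).
HONEST FRAMING: a statement-faithfulness finding about the cell's own typings, with its repair; it
says nothing about the truth of the printed Prop 1.3 and nothing about [IUTchIII] Cor 3.12.
-/

open scoped Pointwise

namespace Literature.AnabelianGeometry.AbsoluteAnabelian

universe u

/-! ## Conjugation transports normalisers and centralisers -/

section GroupTheory

variable {G : Type u} [Group G]

/-- `g·N_G(K)·g⁻¹ = N_G(g·K·g⁻¹)`. [folklore] -/
private theorem mulAut_conj_smul_normalizer (g : G) (K : Subgroup G) :
    MulAut.conj g • Subgroup.normalizer (K : Set G) =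
      Subgroup.normalizer ((MulAut.conj g • K : Subgroup G) : Set G) := by
  have h1 : ∀ S : Subgroup G, MulAut.conj g • S = S.map (MulAut.conj g).toMonoidHom := fun S => rfl
  rw [h1, h1, Subgroup.map_equiv_normalizer_eq]

/-- `g·Z_G(K)·g⁻¹ = Z_G(g·K·g⁻¹)`. [folklore] -/
private theorem mulAut_conj_smul_centralizer (g : G) (K : Subgroup G) :
    MulAut.conj g • Subgroup.centralizer (K : Set G) =
      Subgroup.centralizer ((MulAut.conj g • K : Subgroup G) : Set G) := by
  ext x
  rw [Subgroup.mem_pointwise_smul_iff_inv_smul_mem, Subgroup.mem_centralizer_iff,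
    Subgroup.mem_centralizer_iff]
  constructor
  · intro h m hm
    rw [SetLike.mem_coe, Subgroup.mem_pointwise_smul_iff_inv_smul_mem] at hm
    have e := h _ hm
    rw [← smul_mul', ← smul_mul'] at e
    exact MulAction.injective _ e
  · intro h k hk
    have e := h (MulAut.conj g • k) (Subgroup.smul_mem_pointwise_smul _ _ _ hk)
    apply MulAction.injective (MulAut.conj g)
    simp only [smul_mul', smul_inv_smul]
    exact e

end GroupTheory

/-! ## Certificates at `DPSCData` ([AbsTopII] Prop 1.3 (iv) as typed by abc-iut-L4-t4) -/

namespace DPSCData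

variable (X : DPSCData.{u})

/-- If `g ∈ Π_H` carries `Π_{v'}` onto `Π_v`, it carries `D_{v'} = N_{Π_H}(Π_{v'})` onto `D_v`
("`g·D_{v'}·g⁻¹` is a decomposition group of the vertex `g` moves `v'` to").
[cite: MochizukiAbsTopII2013, Def 1.2 (ii) p.10] -/
theorem conj_smul_Dv_eq {g : X.PiH} {v v' : X.Vert}
    (h : MulAut.conj g • X.vertSub v' = X.vertSub v) : MulAut.conj g • X.Dv v' = X.Dv v := by
  unfold DPSCData.Dv
  rw [mulAut_conj_smul_normalizer, h]

/-- If `g ∈ Π_H` carries `Π_{v'}` onto `Π_v`, it carries `I_{v'} = Z_{Π_I}(Π_{v'})` onto `I_v`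
(`Π_I` being normal in `Π_H`). [cite: MochizukiAbsTopII2013, Def 1.2 (ii) p.10] -/
theorem conj_smul_Iv_eq {g : X.PiH} {v v' : X.Vert}
    (h : MulAut.conj g • X.vertSub v' = X.vertSub v) : MulAut.conj g • X.Iv v' = X.Iv v := by
  haveI : X.PiI.Normal := X.normal_PiI
  unfold DPSCData.Iv
  rw [Subgroup.smul_inf, mulAut_conj_smul_centralizer, h, Subgroup.Normal.conj_smul_eq_self]

/-- **Certificate (iv).a.** `DPSCData.Prop13iv` AS TYPED (conjugating element ranging over `Π_H`)
FAILS as soon as some `g ∈ Π_H` carries `Π_{v'}` onto `Π_v` for two DISTINCT vertices `v ≠ v'` and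
`I_v ≠ 1` (Prop 1.3 (iii): `I_v ≅ Ẑ^Σ`): its "in particular" conjunct `I_v ∩ g·I_{v'}·g⁻¹ ≠ {1} ⇒
v = v'` is violated at this `g` (`g·I_{v'}·g⁻¹ = I_v`).  Print determines `D_{v'}`, `I_{v'}` up to
`Π_𝔾`-conjugacy only; repair: `γ ∈ Π_𝔾`. [cite: MochizukiAbsTopII2013, Prop 1.3 (iv) p.12] -/
theorem not_prop13iv_of_vertSub_moved {v v' : X.Vert} {g : X.PiH}
    (hmove : MulAut.conj g • X.vertSub v' = X.vertSub v) (hne : v ≠ v') (hI : X.Iv v ≠ ⊥) :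
    ¬ X.Prop13iv := by
  intro h
  have h2 := h.2 v v' g
  rw [X.conj_smul_Iv_eq hmove, inf_idem] at h2
  exact hne (h2 hI)

/-- **Certificate (iv).b.** The trichotomy conjunct of `DPSCData.Prop13iv` AS TYPED fails whenever
some `g ∈ Π_H` carries `Π_{v'}` onto `Π_v` for a pair `v, v'` that is neither equal, nor adjacent,
nor at distance two, provided `D_v ∩ Π_I ≠ 1` (it contains `I_v ≅ Ẑ^Σ`): then
`D_v ∩ g·D_{v'}·g⁻¹ ∩ Π_I = D_v ∩ Π_I ≠ {1}` while (1), (2), (3) all fail for the LABELS `v, v'`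
(they hold, in print, for `v` and the vertex `g` moves `v'` to). [cite: MochizukiAbsTopII2013, Prop 1.3 (iv) p.12] -/
theorem not_prop13iv_of_far_vertSub_moved {v v' : X.Vert} {g : X.PiH}
    (hmove : MulAut.conj g • X.vertSub v' = X.vertSub v) (hne : v ≠ v') (hnadj : ¬ X.Adjacent v v')
    (hfar : ¬ ∃ v'' : X.Vert, v'' ≠ v ∧ v'' ≠ v' ∧ X.Adjacent v v'' ∧ X.Adjacent v'' v')
    (hD : X.Dv v ⊓ X.PiI ≠ ⊥) : ¬ X.Prop13iv := by
  intro h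
  have h1 := h.1 v v' g
  rw [X.conj_smul_Dv_eq hmove, inf_idem] at h1
  rcases h1 hD with h | ⟨-, h⟩ | ⟨-, -, h⟩
  · exact hne h
  · exact hnadj h
  · exact hfar h

end DPSCData

/-! ## Certificates at `DPSCIndexData` ([AbsTopII] Prop 1.3 (viii), (x) as typed by abc-iut-L4-t6) -/

namespace AbsTopII.DPSCIndexData

variable (X : DPSCIndexData.{u})

/-- If `g ∈ Π_H` carries `Π_{e'}` onto `Π_e` (nodes), it carries `D_{e'}` onto `D_e`.
[cite: MochizukiAbsTopII2013, Def 1.2 (ii) p.10] -/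
theorem conj_smul_DvNode_eq {g : X.PiH} {e e' : X.Node}
    (h : MulAut.conj g • X.nodeSub e' = X.nodeSub e) : MulAut.conj g • X.DvNode e' = X.DvNode e := by
  unfold DPSCData.DvNode
  rw [mulAut_conj_smul_normalizer, h]

/-- If `g ∈ Π_H` carries `Π_{e'}` onto `Π_e` (cusps), it carries `D_{e'}` onto `D_e`.
[cite: MochizukiAbsTopII2013, Def 1.2 (ii) p.10] -/
theorem conj_smul_DvCusp_eq {g : X.PiH} {e e' : X.Cusp}
    (h : MulAut.conj g • X.cuspSub e' = X.cuspSub e) : MulAut.conj g • X.DvCusp e' = X.DvCusp e := by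
  unfold DPSCData.DvCusp
  rw [mulAut_conj_smul_normalizer, h]

/-- **Certificate (viii), nodes.** `DPSCIndexData.Prop_1_3_viii` AS TYPED (conjugating element
ranging over `Π_H`) FAILS as soon as some `g ∈ Π_H` carries `Π_{e'}` onto `Π_e` for two DISTINCT nodes
`e ≠ e'` with `Π_e ≠ 1`: then `D_e ∩ g·D_{e'}·g⁻¹ ∩ Π_I = D_e ∩ Π_I ⊇ Π_e ≠ {1}`, property (1) fails for
the labels `e, e'`, and property (2) demands `D_e ∩ D_e ∩ Π_𝔾 = {1}`, contradicting `Π_e ⊆ D_e ∩ Π_𝔾`.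
Repair: `γ ∈ Π_𝔾`. [cite: MochizukiAbsTopII2013, Prop 1.3 (viii) p.12] -/
theorem not_prop_1_3_viii_of_nodeSub_moved {e e' : X.Node} {g : X.PiH}
    (hmove : MulAut.conj g • X.nodeSub e' = X.nodeSub e) (hne : e ≠ e') (hPe : X.nodeSub e ≠ ⊥) :
    ¬ X.Prop_1_3_viii := by
  intro h
  have hle : X.nodeSub e ≤ X.DvNode e ⊓ X.DvNode e ⊓ X.PiG :=
    le_inf (le_inf Subgroup.le_normalizer Subgroup.le_normalizer) (X.nodeSub_le e)
  have hleI : X.nodeSub e ≤ X.DvNode e ⊓ X.DvNode e ⊓ X.PiI :=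
    le_inf (le_inf Subgroup.le_normalizer Subgroup.le_normalizer)
      (le_trans (X.nodeSub_le e) X.PiG_le_PiI)
  have h1 := h (Sum.inl e) (Sum.inl e') g
  simp only [DEdge] at h1
  rw [X.conj_smul_DvNode_eq hmove] at h1
  rcases h1 (fun h0 => hPe (le_bot_iff.mp (h0 ▸ hleI))) with h | ⟨-, v, -, -, h0, -⟩
  · exact hne (Sum.inl_injective h)
  · exact hPe (le_bot_iff.mp (h0 ▸ hle))

/-- **Certificate (viii), cusps.** Idem for two distinct cusps `e ≠ e'` with `Π_e ≠ 1` and some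
`g ∈ Π_H` carrying `Π_{e'}` onto `Π_e`. [cite: MochizukiAbsTopII2013, Prop 1.3 (viii) p.12] -/
theorem not_prop_1_3_viii_of_cuspSub_moved {e e' : X.Cusp} {g : X.PiH}
    (hmove : MulAut.conj g • X.cuspSub e' = X.cuspSub e) (hne : e ≠ e') (hPe : X.cuspSub e ≠ ⊥) :
    ¬ X.Prop_1_3_viii := by
  intro h
  have hle : X.cuspSub e ≤ X.DvCusp e ⊓ X.DvCusp e ⊓ X.PiG :=
    le_inf (le_inf Subgroup.le_normalizer Subgroup.le_normalizer) (X.cuspSub_le e)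
  have hleI : X.cuspSub e ≤ X.DvCusp e ⊓ X.DvCusp e ⊓ X.PiI :=
    le_inf (le_inf Subgroup.le_normalizer Subgroup.le_normalizer)
      (le_trans (X.cuspSub_le e) X.PiG_le_PiI)
  have h1 := h (Sum.inr e) (Sum.inr e') g
  simp only [DEdge] at h1
  rw [X.conj_smul_DvCusp_eq hmove] at h1
  rcases h1 (fun h0 => hPe (le_bot_iff.mp (h0 ▸ hleI))) with h | ⟨-, v, -, -, h0, -⟩
  · exact hne (Sum.inr_injective h)
  · exact hPe (le_bot_iff.mp (h0 ▸ hle))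

/-- **Certificate (x).** `DPSCIndexData.Prop_1_3_x` AS TYPED (uniqueness of the cusp `e_τ` "such
that `τ_I(I) ⊆ D_{e_τ}` for SOME `Π_H`-conjugate") FAILS as soon as a non-verticial, non-edge-like
log point is present and every cusp `e` is the target of a DIFFERENT cusp `e' ≠ e` under some
`g ∈ Π_H` (`g·Π_{e'}·g⁻¹ = Π_e`, hence `g·D_{e'}·g⁻¹ = D_e`): `τ_I(I) ⊆ g₀·D_{e_τ}·g₀⁻¹ =
(g₀g)·D_{e'}·(g₀g)⁻¹` would force `e' = e_τ`. Print asks for an appropriate `Π_𝔾`-conjugate;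
repair: `γ ∈ Π_𝔾`. [cite: MochizukiAbsTopII2013, Prop 1.3 (x) p.12] -/
theorem not_prop_1_3_x_of_cusps_moved (τ : X.LogPointData) (hτv : τ.IsNonVerticial)
    (hτe : τ.IsNonEdgeLike)
    (hmoved : ∀ e : X.Cusp, ∃ e' : X.Cusp, e' ≠ e ∧ ∃ g : X.PiH,
      MulAut.conj g • X.cuspSub e' = X.cuspSub e) :
    ¬ X.Prop_1_3_x := by
  intro h
  obtain ⟨e₀, -, huniq⟩ := (h τ).1 hτv hτe
  obtain ⟨g₀, hg₀⟩ := (huniq e₀).mpr rfl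
  obtain ⟨e', hne, g, hg⟩ := hmoved e₀
  have hD : MulAut.conj g • X.DvCusp e' = X.DvCusp e₀ := X.conj_smul_DvCusp_eq hg
  have : τ.image ≤ MulAut.conj (g₀ * g) • X.DvCusp e' := by
    rw [map_mul, mul_smul, hD]
    exact hg₀
  exact hne ((huniq e').mp ⟨g₀ * g, this⟩)

end AbsTopII.DPSCIndexData

end Literature.AnabelianGeometry.AbsoluteAnabelian
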